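import Summits.FinalStateConjecture.FinalStateConjecture.Theorems.ZeroEnergyKerrOrBombHawkingExtensionIsKerrReductionCollar
import Summits.FinalStateConjecture.FinalStateConjecture.Theorems.ZeroEnergyKerrOrBombHawkingExtensionIsKerrHRDefiningFunction
import Summits.FinalStateConjecture.FinalStateConjecture.Theorems.ZeroEnergyKerrOrBombHawkingExtensionIsKerrNHAssembly
import Summits.FinalStateConjecture.FinalStateConjecture.Theorems.ZeroEnergyKerrOrBombHawkingExtensionIsKerrNHGaussNull
import HarnessLib

/-!
# Crux `HawkingExtensionIsKerr` (stmt-FinalStateConjecture-17840), line `SketchIdeator2` —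
# programme NH: `DegenerateVacuumHorizonNoCollar` from the spherical-section fact; the crux from
# FIVE accepted Literature named facts

Helper file of the line lead (c5), registered sub-goal `stub_noCollar_of_sphericalSection`.

* `degenerateVacuumHorizonNoCollar_of_horizonSphericalSection` — the Literature named fact
  `DegenerateVacuumHorizonNoCollar` (`EventHorizonSurfaceGravity.lean`: a DEGENERATE vacuum Killing
  horizon of an `I⁺`-regular hole with connected horizon and simply connected d.o.c. carries no
  Killing-causal collar; printed as a consequence of Gaussian null coordinates, the vacuum
  near-horizon equations of Kunduri–Lucietti 2013 and Gauss–Bonnet) is PROVED from the single,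
  more classical named fact `chruscielCosta2008_horizonSphericalSection` (smooth spherical
  cross-section, Chruściel–Costa 2008 Thm 4.11 / Prop 4.3 / Cor 2.5) by the landed programmes HR
  (smooth local defining functions of the horizon, `exists_horizonDefiningFunction`, p151777) and
  NH (invariant near-horizon sign analysis: one-sided Taylor p155467, second derivative p155709,
  null-frame curvature algebra p155941, `B = 0` p155792, null frame p155977, assembly p157154,
  null Gauss equation `…NHGaussNull`).
* `hawkingExtensionIsKerr_of_five_facts'` — the body of `ZeroEnergyKerrOrBomb.HawkingExtensionIsKerr`
  (rev 9), verbatim, from the FIVE accepted Literature named facts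
  `SudarskyWald1993_staticity`, `ChruscielGalloway2010_docStaticUniqueness`,
  `Chrusciel1997_docAxisymmetricCombination`, `ChruscielCostaHeusler2012_docAxisymmetricUniqueness`
  (uniqueness theory) and `chruscielCosta2008_horizonSphericalSection` (horizon sections), through
  c3's reduction `hawkingExtensionIsKerr_of_five_facts` (p144689, in which the zeroth law is a
  theorem) — the form in which the planner can re-file the crux as a conditional item (`exact`).
-/

noncomputable section

set_option linter.dupNamespace false

namespace Summit.FinalStateConjecture.FinalStateConjecture.Theorems.HawkingExtensionIsKerr.SketchIdeator2

open Literature.Geometry.Lorentzian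
open scoped Manifold ContDiff Topology

/-- **`DegenerateVacuumHorizonNoCollar` from the spherical-section fact (PROVED).**  Regularity of
the horizon (programme HR, `stub_hr_assembly`) feeds the NH assembly (`stub_nh_assembly`) together
with the null Gauss equation (`stub_nh_gaussNull`). -/
theorem degenerateVacuumHorizonNoCollar_of_horizonSphericalSection
    (hS : chruscielCosta2008_horizonSphericalSection) : DegenerateVacuumHorizonNoCollar := by
  intro 𝓑 _ hvac hreg hconn hsc U K hU hHU hKon hKc hKne hnull htan hdeg V hV hHV
  exact stub_nh_assembly stub_nh_gaussNull hS 𝓑 hvac hreg hconn hsc U K hU hHU hKon hKc hKne hnull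
    htan hdeg (stub_hr_assembly 𝓑 U K hU hHU hKon.1 hKne hnull htan) V hV hHV

/-- **Registered sub-goal form** (closed statement, crux stmt-FinalStateConjecture-17840): the
no-collar fact from the spherical-section fact. -/
theorem stub_noCollar_of_sphericalSection : chruscielCosta2008_horizonSphericalSection → DegenerateVacuumHorizonNoCollar :=
  degenerateVacuumHorizonNoCollar_of_horizonSphericalSection

/-- **The crux body from FIVE accepted Literature named facts.**  The body of
`ZeroEnergyKerrOrBomb.HawkingExtensionIsKerr` (rev 9), verbatim, from Sudarsky–Wald staticity,
Chruściel–Galloway static uniqueness, Chruściel 1997 Thm 1.1 (d.o.c. form), Chruściel–Costa–Heusler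
2012 Thm 3.2 (d.o.c. form) and the smooth spherical cross-section fact (Chruściel–Costa 2008), via
`hawkingExtensionIsKerr_of_five_facts` (p144689) and
`degenerateVacuumHorizonNoCollar_of_horizonSphericalSection`. -/
theorem hawkingExtensionIsKerr_of_five_facts' :
    SudarskyWald1993_staticity → ChruscielGalloway2010_docStaticUniqueness → Chrusciel1997_docAxisymmetricCombination → ChruscielCostaHeusler2012_docAxisymmetricUniqueness → chruscielCosta2008_horizonSphericalSection → ∀ (𝓑 : Literature.Geometry.Lorentzian.StationaryAFBlackHole.{0}) [𝓑.metric.HasLeviCivita] [Literature.Geometry.Lorentzian.Kerr.Facts], 𝓑.metric.toPseudoRiemannianMetric.IsRicciFlat → 𝓑.IsIPlusRegular → (∀ p : 𝓑.carrier, p ∈ 𝓑.metric.chronologicalFuture 𝓑.timeOrientation 𝓑.Mext) → (∀ p ∈ 𝓑.doc, 𝓑.killing p ≠ 0) → SimplyConnectedSpace 𝓑.doc → ∀ (U : Set 𝓑.carrier) (K : Π x : 𝓑.carrier, TangentSpace (𝓡 4) x), IsOpen U → 𝓑.horizon ⊆ U → IsConnected 𝓑.horizon → ContMDiffOn (𝓡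 4) ((𝓡 4).prod 𝓘(ℝ, Literature.Geometry.Lorentzian.E4)) ((⊤ : ℕ∞) : WithTop ℕ∞) (fun x ↦ (Bundle.TotalSpace.mk' Literature.Geometry.Lorentzian.E4 x (K x) : TangentBundle (𝓡 4) 𝓑.carrier)) U → (∀ x ∈ U, ∀ v w : TangentSpace (𝓡 4) x, 𝓑.metric.val x (𝓑.metric.leviCivita K x v) w + 𝓑.metric.val x v (𝓑.metric.leviCivita K x w) = 0) → (∀ x ∈ U, VectorField.mlieBracket (𝓡 4) 𝓑.killing K x = 0) → (∀ p ∈ 𝓑.horizon, K p ≠ 0) → (∀ γ : ℝ → 𝓑.carrier, IsMIntegralCurve γ K → γ 0 ∈ 𝓑.horizon → ∀ t, γ t ∈ 𝓑.horizon) → (∀ x ∈ U ∩ 𝓑.doc, 𝓑.metric.val x (K x) (K x) < 0) → (∃ K' : Π x : 𝓑.carrier, TangentSpace (𝓡 4) x, ContMDiffOn (𝓡 4) ((𝓡 4).prod 𝓘(ℝ, Literature.Geometry.Lorentzian.E4)) ((⊤ : ℕ∞) : WithTop ℕ∞) (fun x ↦ (Bundle.TotalSpace.mk' Literature.Geometry.Lorentzian.E4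 x (K' x) : TangentBundle (𝓡 4) 𝓑.carrier)) 𝓑.doc ∧ (∀ x ∈ 𝓑.doc, ∀ v w : TangentSpace (𝓡 4) x, 𝓑.metric.val x (𝓑.metric.leviCivita K' x v) w + 𝓑.metric.val x v (𝓑.metric.leviCivita K' x w) = 0) ∧ (∀ x ∈ 𝓑.doc, VectorField.mlieBracket (𝓡 4) 𝓑.killing K' x = 0) ∧ ∃ U' : Set 𝓑.carrier, IsOpen U' ∧ 𝓑.horizon ⊆ U' ∧ ∀ x ∈ U' ∩ 𝓑.doc, K' x = K x) → ∃ (M a : ℝ), Literature.Geometry.Lorentzian.Kerr.IsSubextremal M a ∧ ∃ Ψ : Literature.Geometry.Lorentzian.Kerr.exterior M a → 𝓑.carrier, Function.Injective Ψ ∧ Set.range Ψ = 𝓑.doc ∧ Literature.Geometry.Lorentzian.PseudoRiemannianMetric.IsIsometricImmersion (Literature.Geometry.Lorentzian.Kerr.smoothMetric M a (Literature.Geometry.Lorentzian.Kerr.rPlus M a)).toPseudoRiemannianMetric 𝓑.metric.toPseudoRiemannianMetric Ψ :=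
  fun h₁ h₂ h₃ h₄ hS ↦ hawkingExtensionIsKerr_of_five_facts
    (degenerateVacuumHorizonNoCollar_of_horizonSphericalSection hS) h₁ h₂ h₃ h₄

end Summit.FinalStateConjecture.FinalStateConjecture.Theorems.HawkingExtensionIsKerr.SketchIdeator2

end
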